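import Mathlib

/-!
# `BalabanUV.Beta.D1BFx.LinearGaugeTrace` — road «BF-x» for binder row D1, slot (K), census groups G_Λ ∕ NEEDLES, FINDING F-g9-1 brick **«LG-TRACE» (MODEL)**:
# the one-line mechanism behind the zero-momentum Ward letter (III) — if the first-order tables of an operator family SUM to a commutator with one
# fixed operator `C` («linear-gauge letters» `Σ_s X_s = [C, B]`, `Σ_s Z_s = [C, Y]`), then the summed bubble-plus-seagull of any insertion `Y` against the
# two-sided inverse `G = B⁻¹` VANISHES: `Σ_s (−tr(G·X_s·G·Y) + tr(G·Z_s)) = −tr(G[C,B]G·Y) + tr(G[C,Y]) = tr([C,G]·Y) + tr(G[C,Y]) = 0` (cyclicity)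

HONEST DEPENDENCY (cell records, verbatim): «continuum YM on T⁴ ⇐ BetaPertH ∧ nine spine estimates (0/9 proved); BetaPertH ⇐ (D1) ∧ (D4) ∧
CAP+tail; G-an2-4 gates asym, D1 and NE2/3/4.»  HONEST FRAMING (cell contract, verbatim): «discharging `BetaPertH` makes Bałaban's UV stability
UNCONDITIONAL — a real constructive-QFT result; it is NOT the continuum limit and NOT the Clay problem.»  THIS MODULE DISCHARGES NOTHING of (K),
of D1 or of the wall: [folklore] finite-dimensional matrix algebra (Mathlib `Matrix.trace_mul_comm`) over ABSTRACT data on a finite index type — the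
MODEL of the lattice statement (whose `ℤ⁴` form needs the Fubini ∕ cyclicity bricks of `KernelWard` §3–§4 under decay majorants with a polynomially
growing diagonal `C`; NOT done here).  No definition, no `def … : Prop`, nothing cited, no wall binder instantiated, 0 sorry.  It asserts NO linear-gauge
letter for any typed table of the cell (those are the stencil owners': LG-E′ passes an3-g52's exact check; kernel file by leaf-04).  NOT D1, NOT BetaPertH,
NOT continuum, NOT Clay.

ABSOLUTE RULE (cell charter, verbatim): «No internally-minted statement may enter as a cited fact. Every hypothesis is either kernel-proved in this
package or a verbatim quotation of a PUBLISHED theorem with page reference. The manuscript(s) under audit are NOT citable for their own disputed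
steps — they are the thing under adjudication; programme-internal (2001/route/tribunal) claims are never citable.»

WHERE THIS SITS (`HOME/b2b-balaban-beta-d1-p2/K-CLOSURE-PLAN-R1L.md` §6, FINDING F-g9-1): letter (III) of the G_Λ row and the needle group's zero-momentum
cancellation reduce to per-table linear-gauge letters `Σ_{u′} X κ″ u′ = [C_κ″, X₀]` plus THIS trace identity.  Unit `b2b-balaban-beta-d1-p2` (road owner, gen 9).
-/

namespace Summit.QuantumFields.BalabanUV.Beta.D1BFx.LinearGaugeTrace

open Matrix

variable {R : Type*} [CommRing R] {ι : Type*} [Fintype ι] [DecidableEq ι]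

/-- [folklore] **RESOLVENT FORM OF A COMMUTATOR LETTER**: for a two-sided inverse `G` of `B`, `G·[C,B]·G = −[C,G]`, i.e. `G(CB − BC)G = GC − CG`. -/
theorem inv_mul_comm_mul_inv (B G C : Matrix ι ι R) (hGB : G * B = 1) (hBG : B * G = 1) :
    G * (C * B - B * C) * G = G * C - C * G := by
  rw [Matrix.mul_sub, Matrix.sub_mul]
  have h1 : G * (C * B) * G = G * C := by rw [← Matrix.mul_assoc, Matrix.mul_assoc (G * C) B G, hBG, Matrix.mul_one]
  have h2 : G * (B * C) * G = C * G := by rw [← Matrix.mul_assoc, hGB, Matrix.one_mul]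
  rw [h1, h2]

/-- [folklore] **«LG-TRACE», COMMUTATOR FORM**: `−tr(G·[C,B]·G·Y) + tr(G·[C,Y]) = 0` for a two-sided inverse `G` of `B` and ANY `C`, `Y` (the bubble of the
summed first-order tables against the insertion `Y`, plus the summed seagull, cancel by cyclicity of the trace). -/
theorem trace_bubble_add_seagull_comm_eq_zero (B G C Y : Matrix ι ι R) (hGB : G * B = 1) (hBG : B * G = 1) :
    -(G * (C * B - B * C) * G * Y).trace + (G * (C * Y - Y * C)).trace = 0 := by
  rw [inv_mul_comm_mul_inv B G C hGB hBG, Matrix.sub_mul, Matrix.mul_sub, Matrix.trace_sub, Matrix.trace_sub]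
  have h1 : (C * G * Y).trace = (G * (Y * C)).trace := by
    rw [Matrix.mul_assoc, Matrix.trace_mul_comm C (G * Y), Matrix.mul_assoc]
  have h2 : (G * (C * Y)).trace = (G * C * Y).trace := by rw [Matrix.mul_assoc]
  rw [h1, h2]
  ring

/-- [folklore] **«LG-TRACE», SUMMED-TABLE FORM** (the shape letter (III) is used in): if finite families of first-order tables `X s` (of the operator) and
`Z s` (of the insertion) satisfy the LINEAR-GAUGE LETTERS `Σ_s X s = C·B − B·C` and `Σ_s Z s = C·Y − Y·C`, then the summed bubble-plus-seagull vanishes: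
`Σ_s (−tr(G·X s·G·Y) + tr(G·Z s)) = 0`. -/
theorem sum_bubble_add_seagull_eq_zero {σ : Type*} (s : Finset σ) (B G C Y : Matrix ι ι R) (X Z : σ → Matrix ι ι R)
    (hGB : G * B = 1) (hBG : B * G = 1) (hX : ∑ i ∈ s, X i = C * B - B * C) (hZ : ∑ i ∈ s, Z i = C * Y - Y * C) :
    ∑ i ∈ s, (-(G * X i * G * Y).trace + (G * Z i).trace) = 0 := by
  have h1 : ∑ i ∈ s, (G * X i * G * Y).trace = (G * (C * B - B * C) * G * Y).trace := by
    rw [← hX, Matrix.mul_sum, Finset.sum_mul, Finset.sum_mul, Matrix.trace_sum]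
  have h2 : ∑ i ∈ s, (G * Z i).trace = (G * (C * Y - Y * C)).trace := by
    rw [← hZ, Matrix.mul_sum, Matrix.trace_sum]
  rw [Finset.sum_add_distrib, Finset.sum_neg_distrib, h1, h2]
  exact trace_bubble_add_seagull_comm_eq_zero B G C Y hGB hBG

/-- [folklore] **ZERO-MOMENTUM WARD OF THE FULL BUBBLE, MODEL** (the needle group's companion): if BOTH vertex families sum to commutators with the SAME `C`
(`Σ_s X s = [C,B]`, `Σ_t X′ t = [C′,B]` is NOT needed — one summed slot suffices against a `C`-COMMUTING partner), in particular for a partner `Y` with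
`C·Y = Y·C` the summed bubble alone vanishes: `Σ_s tr(G·X s·G·Y) = 0`. -/
theorem sum_bubble_eq_zero_of_comm {σ : Type*} (s : Finset σ) (B G C Y : Matrix ι ι R) (X : σ → Matrix ι ι R)
    (hGB : G * B = 1) (hBG : B * G = 1) (hX : ∑ i ∈ s, X i = C * B - B * C) (hY : C * Y = Y * C) :
    ∑ i ∈ s, (G * X i * G * Y).trace = 0 := by
  have h := sum_bubble_add_seagull_eq_zero s B G C Y X (fun _ => 0) hGB hBG hX (by rw [Finset.sum_const_zero, hY, sub_self])
  simp only [Matrix.mul_zero, Matrix.trace_zero, add_zero, Finset.sum_neg_distrib, neg_eq_zero] at h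
  exact h

end Summit.QuantumFields.BalabanUV.Beta.D1BFx.LinearGaugeTrace
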